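/-
Copyright (c) 2026 the pub-hodgecm-mathlib formalisation cell (harness21).  Prover seat hodgecm-mathlib-F0P3-p01 (g30), «(D-RAM) FOUR-FRAME» road of crux H413, line LH4, MS ROAD A,
STAGE B (LH4-p10 (g2) deal sheet 2026-09-03T23:26:42Z, brick B1 «RESIDUE COUNTS», SPEC-StageB v1 §A), FILE 1 of 2: the ADDITIVE residue counts of a ramified quadratic datum.  2026-09-03∕04.
-/
import Literature.NumberTheory.Automorphic.ValuationBallStableSubgroupIndex   -- ★ (F0P3a-p09): `relIndex_leAddSubgroup_inf_shift` (shift invariance of `[B_F(m) : B_F(n)]`); brings ★ `SubgroupIndexDevissage` (`relIndex_leAddSubgroup_exp`, `map_mulLeft_leAddSubgroup`)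
import Literature.NumberTheory.LocalFields.WildQuadraticDatumTrace            -- ★ p854561 (LH4-p03): the datum toolkit (`map_varpi_ne`, `even_log_v_of_fixed`, `v_varpi_pow`); brings ★ `WildQuadraticEisensteinFrame` (`exists_fixed_coords_of_map_ne`, `v_fixed_add_fixed_mul_eq_max`)
import HarnessLib

/-!
# Residue counts of a RAMIFIED QUADRATIC DATUM, I (additive side): `[𝒪_E : 𝔭_Eⁿ] = qⁿ`, `[𝒪_F : 𝒪_F ∩ 𝔭_Eⁿ] = q^{⌈n∕2⌉}`, `[𝒪_E : 𝒪_F + 𝔭_Eⁿ] = q^{⌊n∕2⌋}`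
# (Serre, *Local Fields*, Ch. II §3 Prop. 5; Ch. I §6 — a totally ramified quadratic extension has the residue field of its base)

Topic `NumberTheory/LocalFields`; namespace `Literature.NumberTheory.LocalFields.WildQuadraticDatum` (the one-field datum of ★ `WildQuadraticDatumTrace`: `σ` an involution of a
discretely valued field `K` with `v ∘ σ = v`, non-zero `σ`-fixed elements of EVEN valuation, `ϖ` a uniformiser, `|ϖ − σϖ| = |ϖ|^d`; the fixed field `F = K^σ` is NEVER a type).
THEOREMS ONLY (no definition, no instance, no notation, no named fact, no `sorry`).  Cell `pub/hodgecm-mathlib` (D-0151), crux H413 = `stmt-HodgeConjecture-24833`; helper lane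
`--supports stmt-HodgeConjecture-24833`; MS road A, Stage B («N_tv = [k]_q», LH4-p10 (g2) MEMO-stableLaw-finite v2 ∕ SPEC-StageB v1 §A): the residue-count primitives (C1), (C2) of brick B1
(the unit-side primitives (C3)–(C5) are FILE 2).  No completeness anywhere; `[Finite 𝓀[K]]` only; `q := Nat.card 𝓀[K]`.

CURRENCY (define-free).  Balls `B(k) := {x | v x ≤ exp k}` = `(Valued.v).leAddSubgroup (exp k)` (so `𝒪_E = B(0)`, `𝔭_Eⁿ = B(−n)`); the `σ`-FIXED additive subgroup
`Fix := ker(σ − id) = (σ.toAddMonoidHom − AddMonoidHom.id K).ker`; `𝒪_F := B(0) ⊓ Fix` (SPEC's «`{x ∈ 𝒪_E | σ x = x}`»), the fixed balls `B_F(k) := B(k) ⊓ Fix`.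

THE MATHEMATICS.  (C1) `[B(0) : B(−n)] = qⁿ` is ★ `relIndex_leAddSubgroup_exp` (re-exported, also in the `ϖⁿ·𝒪` spelling).  FIXED BALLS: a non-zero fixed element has even valuation, so
`B_F(2m+1) = B_F(2m)` (`fixedBall_inf_odd_eq`); every integer is `a + bϖ` with `a, b` FIXED INTEGERS (★ `exists_fixed_coords_of_map_ne` + parity ★ `v_fixed_add_fixed_mul_eq_max`), so
`B(0) = 𝒪_F ⊔ B(−1)` («every residue class has a `σ`-fixed representative», `fixedBall_sup_ball_eq`) and `𝒪_F ⊓ B(−1) = B_F(−2)`; reading ★ `[B(0) : B(−1)] = q` through the second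
isomorphism theorem gives `[B_F(0) : B_F(−2)] = q`, and the shift by the fixed `π₀ = ϖσϖ` (`|π₀| = exp(−2)`, ★ `relIndex_leAddSubgroup_inf_shift`) gives `[B_F(m) : B_F(m−2)] = q` for every
`m` (`relIndex_fixedBall_step`), hence `[B_F(0) : B_F(−n)] = q^{⌈n∕2⌉}` (`relIndex_fixedBall_eq_pow`, «the residue field of `F` is that of `E`, and `𝔭_F = 𝔭_E² ∩ F`»).  (C2) From
`B(−n) ≤ 𝒪_F ⊔ B(−n) ≤ B(0)`: `qⁿ = [B(0) : 𝒪_F ⊔ B(−n)] · [𝒪_F ⊔ B(−n) : B(−n)]` and `[𝒪_F ⊔ B(−n) : B(−n)] = [𝒪_F : 𝒪_F ⊓ B(−n)] = q^{⌈n∕2⌉}`, so `[𝒪_E : 𝒪_F + 𝔭ⁿ] = q^{⌊n∕2⌋}`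
(`relIndex_fixed_sup_ball_eq_pow`: «a class mod `𝔭_Eⁿ` contains a `σ`-fixed element iff …; there are `q^{⌈n∕2⌉}` such classes»).

* §1 (C1) `relIndex_ball_neg_natCast_eq_pow`, `relIndex_map_mulLeft_varpi_pow_eq_pow`.
* §2 `mem_fixedSubgroup_iff`, `fixedBall_inf_odd_eq`, `fixedBall_neg_one_eq`, `fixedBall_sup_ball_eq`, `relIndex_fixedBall_zero_neg_two`, `relIndex_fixedBall_step`, **`relIndex_fixedBall_eq_pow`**.
* §3 (C2) **`relIndex_fixed_sup_ball_eq_pow`**.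

HONEST LABEL: HC_CM is proved only modulo the 7 printed citations (2 remaining named inputs: hLiu418 = stmt-HodgeConjecture-24832, h413 = stmt-HodgeConjecture-24833) until rung 0
closes; count-neutral brick (elementary valuation ∕ index algebra; nothing printed is asserted).

## References
* [Serre1979] J.-P. Serre, *Local Fields*, GTM 67 (1979), Ch. II §3 Prop. 5 (the filtration `𝔭ⁿ` and its indices), Ch. I §6 Prop. 18 (totally ramified extensions: `𝒪_E = 𝒪_F[ϖ]`, same residue field).
* [WeilBNT1967] A. Weil, *Basic Number Theory*, Grundlehren 144 (1967), Ch. I §4 (the module `q`).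
-/

set_option autoImplicit false

open WithZero
open scoped Valued

namespace Literature.NumberTheory.LocalFields.WildQuadraticDatum

open Literature.NumberTheory.Automorphic

variable {K : Type*} [Field K] [Valued K ℤᵐ⁰] {σ : K →+* K} {ϖ : K} {d : ℕ}

/-! ## §1 (C1) `[𝒪_E : 𝔭_Eⁿ] = qⁿ` -/

/-- **(C1) `[𝒪_E : 𝔭_Eⁿ] = qⁿ`** in ball currency: `[B(0) : B(−n)] = q^n` (★ `relIndex_leAddSubgroup_exp`). [cite: Serre1979, Ch. II §3 Prop. 5] -/
theorem relIndex_ball_neg_natCast_eq_pow (hϖ : Valued.v ϖ = exp (-1 : ℤ)) [Finite 𝓀[K]] (n : ℕ) :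
    ((Valued.v : Valuation K ℤᵐ⁰).leAddSubgroup (exp (-(n : ℤ)))).relIndex ((Valued.v : Valuation K ℤᵐ⁰).leAddSubgroup (exp (0 : ℤ))) =
      Nat.card 𝓀[K] ^ n := by
  rw [relIndex_leAddSubgroup_exp hϖ]; congr 1; omega

/-- **(C1) in uniformiser currency: `[𝒪_E : ϖⁿ𝒪_E] = qⁿ`** (`ϖⁿ·B(0) = B(−n)`, ★ `map_mulLeft_leAddSubgroup`). [cite: Serre1979, Ch. II §3 Prop. 5] -/
theorem relIndex_map_mulLeft_varpi_pow_eq_pow (hϖ : Valued.v ϖ = exp (-1 : ℤ)) [Finite 𝓀[K]] (n : ℕ) :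
    (((Valued.v : Valuation K ℤᵐ⁰).leAddSubgroup (exp (0 : ℤ))).map (AddMonoidHom.mulLeft (ϖ ^ n))).relIndex
        ((Valued.v : Valuation K ℤᵐ⁰).leAddSubgroup (exp (0 : ℤ))) = Nat.card 𝓀[K] ^ n := by
  have hϖ0 : ϖ ≠ 0 := fun h => by rw [h, map_zero] at hϖ; exact (exp_ne_zero hϖ.symm).elim
  rw [map_mulLeft_leAddSubgroup (pow_ne_zero n hϖ0), map_pow, v_varpi_pow hϖ, ← exp_add, add_zero]
  exact relIndex_ball_neg_natCast_eq_pow hϖ n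

/-! ## §2 The `σ`-fixed balls `B_F(k) = B(k) ⊓ ker(σ − id)`: parity, fixed representatives of residue classes, `[B_F(m) : B_F(m−2)] = q`, `[B_F(0) : B_F(−n)] = q^{⌈n∕2⌉}` -/

omit [Valued K ℤᵐ⁰] in
/-- Membership in the fixed subgroup `ker(σ − id)`. [cite: Serre1979, Ch. I §6] -/
theorem mem_fixedSubgroup_iff (x : K) : x ∈ (σ.toAddMonoidHom - AddMonoidHom.id K).ker ↔ σ x = x := by
  rw [AddMonoidHom.mem_ker, AddMonoidHom.sub_apply, sub_eq_zero]; rfl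

/-- **PARITY: `B_F(2m+1) = B_F(2m)`** — a non-zero `σ`-fixed element has even valuation. [cite: Serre1979, Ch. I §6 Prop. 18] -/
theorem fixedBall_inf_odd_eq (hfix : ∀ x : K, σ x = x → x ≠ 0 → ∃ n : ℤ, Valued.v x = exp (2 * n)) (m : ℤ) :
    (Valued.v : Valuation K ℤᵐ⁰).leAddSubgroup (exp (2 * m + 1)) ⊓ (σ.toAddMonoidHom - AddMonoidHom.id K).ker =
      (Valued.v : Valuation K ℤᵐ⁰).leAddSubgroup (exp (2 * m)) ⊓ (σ.toAddMonoidHom - AddMonoidHom.id K).ker := by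
  refine le_antisymm ?_ (inf_le_inf_right _ (Valuation.leAddSubgroup_monotone _ (exp_le_exp.2 (by omega))))
  intro x hx'
  rw [AddSubgroup.mem_inf] at hx' ⊢
  obtain ⟨hx, hσx⟩ := hx'
  refine ⟨?_, hσx⟩
  rw [Valuation.mem_leAddSubgroup_iff] at hx ⊢
  rcases eq_or_ne x 0 with rfl | hx0
  · rw [map_zero]; exact zero_le
  · obtain ⟨n, hn⟩ := hfix x ((mem_fixedSubgroup_iff x).1 hσx) hx0
    rw [hn, exp_le_exp] at hx ⊢
    omega

/-- `B_F(−1) = B_F(−2)` (the case `m = −1` of the parity clause). [cite: Serre1979, Ch. I §6 Prop. 18] -/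
theorem fixedBall_neg_one_eq (hfix : ∀ x : K, σ x = x → x ≠ 0 → ∃ n : ℤ, Valued.v x = exp (2 * n)) :
    (Valued.v : Valuation K ℤᵐ⁰).leAddSubgroup (exp (-1 : ℤ)) ⊓ (σ.toAddMonoidHom - AddMonoidHom.id K).ker =
      (Valued.v : Valuation K ℤᵐ⁰).leAddSubgroup (exp (-2 : ℤ)) ⊓ (σ.toAddMonoidHom - AddMonoidHom.id K).ker := by
  have h := fixedBall_inf_odd_eq hfix (-1)
  norm_num at h
  exact h

/-- **EVERY RESIDUE CLASS HAS A `σ`-FIXED REPRESENTATIVE: `𝒪_F ⊔ 𝔭_E = 𝒪_E`**, i.e. `(B(0) ⊓ Fix) ⊔ B(−1) = B(0)` — write an integer as `a + bϖ` with `a, b` fixed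
(★ `exists_fixed_coords_of_map_ne`); parity (★ `v_fixed_add_fixed_mul_eq_max`) makes `a` and `b` integers, so `x ≡ a (mod 𝔭_E)`. [cite: Serre1979, Ch. I §6 Prop. 18] -/
theorem fixedBall_sup_ball_eq (hσ : ∀ x, σ (σ x) = x)
    (hfix : ∀ x : K, σ x = x → x ≠ 0 → ∃ n : ℤ, Valued.v x = exp (2 * n)) (hϖ : Valued.v ϖ = exp (-1 : ℤ))
    (hd : Valued.v (ϖ - σ ϖ) = Valued.v ϖ ^ d) :
    ((Valued.v : Valuation K ℤᵐ⁰).leAddSubgroup (exp (0 : ℤ)) ⊓ (σ.toAddMonoidHom - AddMonoidHom.id K).ker) ⊔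
        (Valued.v : Valuation K ℤᵐ⁰).leAddSubgroup (exp (-1 : ℤ)) = (Valued.v : Valuation K ℤᵐ⁰).leAddSubgroup (exp (0 : ℤ)) := by
  refine le_antisymm (sup_le inf_le_left (Valuation.leAddSubgroup_monotone _ (exp_le_exp.2 (by norm_num)))) ?_
  intro x hx
  rw [Valuation.mem_leAddSubgroup_iff, exp_zero] at hx
  obtain ⟨a, b, ha, hb, rfl⟩ := exists_fixed_coords_of_map_ne hσ (map_varpi_ne hϖ hd) x
  have hsplit := v_fixed_add_fixed_mul_eq_max (even_log_v_of_fixed hfix) hϖ ha hb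
  have ha1 : Valued.v a ≤ 1 := (le_max_left _ _).trans (hsplit ▸ hx)
  have hb1 : Valued.v b ≤ 1 := by
    have hle : Valued.v b * exp (-1 : ℤ) ≤ 1 := (le_max_right _ _).trans (hsplit ▸ hx)
    rcases eq_or_ne b 0 with rfl | hb0
    · rw [map_zero]; exact zero_le
    · obtain ⟨m, hm⟩ := even_log_v_of_fixed hfix b hb hb0
      have hvb : Valued.v b = exp (log (Valued.v b)) := (exp_log ((Valuation.ne_zero_iff _).2 hb0)).symm
      rw [hvb, hm, ← exp_add, ← exp_zero, exp_le_exp] at hle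
      rw [hvb, hm, ← exp_zero, exp_le_exp]
      omega
  refine AddSubgroup.add_mem_sup (AddSubgroup.mem_inf.2 ⟨?_, (mem_fixedSubgroup_iff a).2 ha⟩) ?_
  · rw [Valuation.mem_leAddSubgroup_iff, exp_zero]; exact ha1
  · rw [Valuation.mem_leAddSubgroup_iff, map_mul, hϖ]
    exact mul_le_of_le_one_left' hb1

/-- **`[B_F(0) : B_F(−2)] = q`** («the residue field of `F` is the residue field of `E`»): by `𝒪_F ⊔ 𝔭_E = 𝒪_E`, `𝒪_F ⊓ 𝔭_E = B_F(−1) = B_F(−2)` and the second isomorphism theorem,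
`[B_F(0) : B_F(−2)] = [𝒪_E : 𝔭_E] = q` (★ `relIndex_leAddSubgroup_exp`). [cite: Serre1979, Ch. I §6 Prop. 18; Ch. II §3 Prop. 5] -/
theorem relIndex_fixedBall_zero_neg_two (hσ : ∀ x, σ (σ x) = x)
    (hfix : ∀ x : K, σ x = x → x ≠ 0 → ∃ n : ℤ, Valued.v x = exp (2 * n)) (hϖ : Valued.v ϖ = exp (-1 : ℤ))
    (hd : Valued.v (ϖ - σ ϖ) = Valued.v ϖ ^ d) [Finite 𝓀[K]] :
    ((Valued.v : Valuation K ℤᵐ⁰).leAddSubgroup (exp (-2 : ℤ)) ⊓ (σ.toAddMonoidHom - AddMonoidHom.id K).ker).relIndex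
        ((Valued.v : Valuation K ℤᵐ⁰).leAddSubgroup (exp (0 : ℤ)) ⊓ (σ.toAddMonoidHom - AddMonoidHom.id K).ker) = Nat.card 𝓀[K] := by
  set Fx := (σ.toAddMonoidHom - AddMonoidHom.id K).ker
  set B0 := (Valued.v : Valuation K ℤᵐ⁰).leAddSubgroup (exp (0 : ℤ))
  set B1 := (Valued.v : Valuation K ℤᵐ⁰).leAddSubgroup (exp (-1 : ℤ))
  -- `[B(0) : B(−1)] = q`
  have hq : B1.relIndex B0 = Nat.card 𝓀[K] := by
    rw [relIndex_leAddSubgroup_exp hϖ]; norm_num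
  -- second isomorphism: `[𝒪_F ⊔ B(−1) : B(−1)] = [𝒪_F : 𝒪_F ⊓ B(−1)]`
  have h2 : B1.relIndex ((B0 ⊓ Fx) ⊔ B1) = B1.relIndex (B0 ⊓ Fx) := AddSubgroup.relIndex_sup_right _ _
  rw [fixedBall_sup_ball_eq hσ hfix hϖ hd] at h2
  -- `B(−1).relIndex (B(0) ⊓ Fix) = (B(−1) ⊓ (B(0) ⊓ Fix)).relIndex (B(0) ⊓ Fix)` and `B(−1) ⊓ B(0) ⊓ Fix = B_F(−1) = B_F(−2)`
  have h3 : B1 ⊓ (B0 ⊓ Fx) = (Valued.v : Valuation K ℤᵐ⁰).leAddSubgroup (exp (-2 : ℤ)) ⊓ Fx := by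
    rw [← inf_assoc, inf_eq_left.2 (Valuation.leAddSubgroup_monotone _ (exp_le_exp.2 (by norm_num)) : B1 ≤ B0)]
    exact fixedBall_neg_one_eq hfix
  rw [← hq, h2, ← AddSubgroup.inf_relIndex_right B1 (B0 ⊓ Fx), h3]

/-- **`[B_F(m) : B_F(m−2)] = q` for every `m ∈ ℤ`**: the fixed norm `π₀ = ϖσϖ` (`|π₀| = exp(−2)`) multiplies `Fix` into itself, so the index is shift-invariant
(★ `relIndex_leAddSubgroup_inf_shift`) and equals `[B_F(0) : B_F(−2)] = q`. [cite: Serre1979, Ch. II §3 Prop. 5] [cite: WeilBNT1967, Ch. I §4] -/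
theorem relIndex_fixedBall_step (hσ : ∀ x, σ (σ x) = x) (hvσ : ∀ a, Valued.v (σ a) = Valued.v a)
    (hfix : ∀ x : K, σ x = x → x ≠ 0 → ∃ n : ℤ, Valued.v x = exp (2 * n)) (hϖ : Valued.v ϖ = exp (-1 : ℤ))
    (hd : Valued.v (ϖ - σ ϖ) = Valued.v ϖ ^ d) [Finite 𝓀[K]] (m : ℤ) :
    ((Valued.v : Valuation K ℤᵐ⁰).leAddSubgroup (exp (m - 2)) ⊓ (σ.toAddMonoidHom - AddMonoidHom.id K).ker).relIndex
        ((Valued.v : Valuation K ℤᵐ⁰).leAddSubgroup (exp m) ⊓ (σ.toAddMonoidHom - AddMonoidHom.id K).ker) = Nat.card 𝓀[K] := by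
  -- the fixed scalar `π₀ = ϖσϖ`
  have hc : Valued.v (ϖ * σ ϖ) = exp (-(2 : ℤ)) := by rw [map_mul, hvσ, hϖ, ← exp_add]; norm_num
  have hσc : σ (ϖ * σ ϖ) = ϖ * σ ϖ := by rw [map_mul, hσ, mul_comm]
  have hcF : ∀ x ∈ (σ.toAddMonoidHom - AddMonoidHom.id K).ker, ϖ * σ ϖ * x ∈ (σ.toAddMonoidHom - AddMonoidHom.id K).ker := fun x hx => by
    rw [mem_fixedSubgroup_iff] at hx ⊢; rw [map_mul, hσc, hx]
  have hcF' : ∀ x ∈ (σ.toAddMonoidHom - AddMonoidHom.id K).ker, (ϖ * σ ϖ)⁻¹ * x ∈ (σ.toAddMonoidHom - AddMonoidHom.id K).ker := fun x hx => by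
    rw [mem_fixedSubgroup_iff] at hx ⊢; rw [map_mul, map_inv₀, hσc, hx]
  -- shift `m − 2 ↦ m − 2 + 2·j`: reduce to `m' = 0`… in one step: `[B_F(m−2+2t) : B_F(m+2t)]` is constant in `t`; take `t` with `m = 2t` or `m = 2t + 1`
  have hshift := fun a b : ℤ => relIndex_leAddSubgroup_inf_shift_mul ((σ.toAddMonoidHom - AddMonoidHom.id K).ker) hc hcF hcF' a b
  have h0 := relIndex_fixedBall_zero_neg_two hσ hfix hϖ hd
  rcases Int.even_or_odd m with ⟨t, ht⟩ | ⟨t, ht⟩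
  · -- `m = 2t`: shift `[B_F(−2) : B_F(0)]` by `2t`
    have h := hshift (-2) 0 t
    rw [show (-2 : ℤ) + 2 * t = m - 2 by omega, show (0 : ℤ) + 2 * t = m by omega] at h
    rw [h, h0]
  · -- `m = 2t + 1`: `B_F(m) = B_F(2t)`, `B_F(m − 2) = B_F(2t − 2) = B_F(2(t−1)+1)`… use parity on both ends, then the even case
    have hm : (Valued.v : Valuation K ℤᵐ⁰).leAddSubgroup (exp m) ⊓ (σ.toAddMonoidHom - AddMonoidHom.id K).ker =
        (Valued.v : Valuation K ℤᵐ⁰).leAddSubgroup (exp (2 * t)) ⊓ (σ.toAddMonoidHom - AddMonoidHom.id K).ker := by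
      rw [ht]; exact fixedBall_inf_odd_eq hfix t
    have hm2 : (Valued.v : Valuation K ℤᵐ⁰).leAddSubgroup (exp (m - 2)) ⊓ (σ.toAddMonoidHom - AddMonoidHom.id K).ker =
        (Valued.v : Valuation K ℤᵐ⁰).leAddSubgroup (exp (2 * (t - 1))) ⊓ (σ.toAddMonoidHom - AddMonoidHom.id K).ker := by
      rw [show m - 2 = 2 * (t - 1) + 1 by omega]; exact fixedBall_inf_odd_eq hfix (t - 1)
    have h := hshift (-2) 0 t
    rw [show (-2 : ℤ) + 2 * t = 2 * (t - 1) by omega, show (0 : ℤ) + 2 * t = 2 * t by omega] at h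
    rw [hm, hm2, h, h0]

/-- **`[𝒪_F : 𝒪_F ∩ 𝔭_Eⁿ] = q^{⌈n∕2⌉}`**: `[B_F(0) : B_F(−n)] = q^{(n+1)∕2}` (ℕ-division) — telescope the steps `[B_F(m) : B_F(m−2)] = q` and absorb the odd end by parity.
[cite: Serre1979, Ch. II §3 Prop. 5; Ch. I §6 Prop. 18] -/
theorem relIndex_fixedBall_eq_pow (hσ : ∀ x, σ (σ x) = x) (hvσ : ∀ a, Valued.v (σ a) = Valued.v a)
    (hfix : ∀ x : K, σ x = x → x ≠ 0 → ∃ n : ℤ, Valued.v x = exp (2 * n)) (hϖ : Valued.v ϖ = exp (-1 : ℤ))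
    (hd : Valued.v (ϖ - σ ϖ) = Valued.v ϖ ^ d) [Finite 𝓀[K]] (n : ℕ) :
    ((Valued.v : Valuation K ℤᵐ⁰).leAddSubgroup (exp (-(n : ℤ))) ⊓ (σ.toAddMonoidHom - AddMonoidHom.id K).ker).relIndex
        ((Valued.v : Valuation K ℤᵐ⁰).leAddSubgroup (exp (0 : ℤ)) ⊓ (σ.toAddMonoidHom - AddMonoidHom.id K).ker) = Nat.card 𝓀[K] ^ ((n + 1) / 2) := by
  set Fx := (σ.toAddMonoidHom - AddMonoidHom.id K).ker
  -- even levels: `[B_F(0) : B_F(−2j)] = q^j`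
  have heven : ∀ j : ℕ, ((Valued.v : Valuation K ℤᵐ⁰).leAddSubgroup (exp (-(2 * (j : ℤ)))) ⊓ Fx).relIndex
      ((Valued.v : Valuation K ℤᵐ⁰).leAddSubgroup (exp (0 : ℤ)) ⊓ Fx) = Nat.card 𝓀[K] ^ j := by
    intro j
    induction j with
    | zero => rw [Nat.cast_zero, mul_zero, neg_zero, pow_zero, AddSubgroup.relIndex_self]
    | succ j ih =>
      have hle₁ : (Valued.v : Valuation K ℤᵐ⁰).leAddSubgroup (exp (-(2 * ((j + 1 : ℕ) : ℤ)))) ⊓ Fx ≤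
          (Valued.v : Valuation K ℤᵐ⁰).leAddSubgroup (exp (-(2 * (j : ℤ)))) ⊓ Fx :=
        inf_le_inf_right _ (Valuation.leAddSubgroup_monotone _ (exp_le_exp.2 (by push_cast; omega)))
      have hle₂ : (Valued.v : Valuation K ℤᵐ⁰).leAddSubgroup (exp (-(2 * (j : ℤ)))) ⊓ Fx ≤
          (Valued.v : Valuation K ℤᵐ⁰).leAddSubgroup (exp (0 : ℤ)) ⊓ Fx :=
        inf_le_inf_right _ (Valuation.leAddSubgroup_monotone _ (exp_le_exp.2 (by omega)))
      have hstep := relIndex_fixedBall_step hσ hvσ hfix hϖ hd (-(2 * (j : ℤ)))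
      rw [show (-(2 * (j : ℤ)) - 2) = -(2 * ((j + 1 : ℕ) : ℤ)) by push_cast; ring] at hstep
      rw [← AddSubgroup.relIndex_mul_relIndex _ _ _ hle₁ hle₂, hstep, ih, pow_succ, mul_comm]
  rcases Nat.even_or_odd n with ⟨j, hj⟩ | ⟨j, hj⟩
  · -- `n = 2j`
    have h := heven j
    rw [show (-(2 * (j : ℤ))) = -((n : ℤ)) by rw [hj]; push_cast; ring] at h
    rw [h]; congr 1; omega
  · -- `n = 2j + 1`: `B_F(−(2j+1)) = B_F(−(2j+2))`
    have hpar : (Valued.v : Valuation K ℤᵐ⁰).leAddSubgroup (exp (-(n : ℤ))) ⊓ Fx =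
        (Valued.v : Valuation K ℤᵐ⁰).leAddSubgroup (exp (-(2 * ((j + 1 : ℕ) : ℤ)))) ⊓ Fx := by
      rw [show (-(n : ℤ)) = 2 * (-((j : ℤ) + 1)) + 1 by rw [hj]; push_cast; ring,
        show (-(2 * ((j + 1 : ℕ) : ℤ))) = 2 * (-((j : ℤ) + 1)) by push_cast; ring]
      exact fixedBall_inf_odd_eq hfix _
    rw [hpar, heven (j + 1)]; congr 1; omega

/-! ## §3 (C2) `[𝒪_E : 𝒪_F + 𝔭_Eⁿ] = q^{⌊n∕2⌋}` -/

/-- **(C2) `[𝒪_E : 𝒪_F + 𝔭_Eⁿ] = q^{⌊n∕2⌋}`**: `((B(0) ⊓ Fix) ⊔ B(−n)).relIndex (B(0)) = q^{n∕2}` (ℕ-division) — from `B(−n) ≤ 𝒪_F ⊔ B(−n) ≤ B(0)`: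
`qⁿ = [B(0) : 𝒪_F ⊔ B(−n)]·[𝒪_F ⊔ B(−n) : B(−n)]` (★ `relIndex_mul_relIndex`, (C1)) and `[𝒪_F ⊔ B(−n) : B(−n)] = [𝒪_F : 𝒪_F ⊓ B(−n)] = q^{⌈n∕2⌉}` (second isomorphism, §2).
Equivalently: a residue class mod `𝔭_Eⁿ` contains a `σ`-fixed integer iff it lies in the image of `𝒪_F`, and there are `q^{⌈n∕2⌉}` such classes. [cite: Serre1979, Ch. II §3 Prop. 5; Ch. I §6 Prop. 18] -/
theorem relIndex_fixed_sup_ball_eq_pow (hσ : ∀ x, σ (σ x) = x) (hvσ : ∀ a, Valued.v (σ a) = Valued.v a)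
    (hfix : ∀ x : K, σ x = x → x ≠ 0 → ∃ n : ℤ, Valued.v x = exp (2 * n)) (hϖ : Valued.v ϖ = exp (-1 : ℤ))
    (hd : Valued.v (ϖ - σ ϖ) = Valued.v ϖ ^ d) [Finite 𝓀[K]] (n : ℕ) :
    (((Valued.v : Valuation K ℤᵐ⁰).leAddSubgroup (exp (0 : ℤ)) ⊓ (σ.toAddMonoidHom - AddMonoidHom.id K).ker) ⊔
        (Valued.v : Valuation K ℤᵐ⁰).leAddSubgroup (exp (-(n : ℤ)))).relIndex ((Valued.v : Valuation K ℤᵐ⁰).leAddSubgroup (exp (0 : ℤ))) =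
      Nat.card 𝓀[K] ^ (n / 2) := by
  set Fx := (σ.toAddMonoidHom - AddMonoidHom.id K).ker
  set B0 := (Valued.v : Valuation K ℤᵐ⁰).leAddSubgroup (exp (0 : ℤ))
  set Bn := (Valued.v : Valuation K ℤᵐ⁰).leAddSubgroup (exp (-(n : ℤ)))
  have hq0 : Nat.card 𝓀[K] ≠ 0 := Nat.card_pos.ne'
  have hBn0 : Bn ≤ B0 := Valuation.leAddSubgroup_monotone _ (exp_le_exp.2 (by omega))
  have hle₁ : Bn ≤ (B0 ⊓ Fx) ⊔ Bn := le_sup_right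
  have hle₂ : (B0 ⊓ Fx) ⊔ Bn ≤ B0 := sup_le inf_le_left hBn0
  -- `[B0 : Bn] = [B0 : 𝒪_F ⊔ Bn] · [𝒪_F ⊔ Bn : Bn]`
  have hmul := AddSubgroup.relIndex_mul_relIndex Bn ((B0 ⊓ Fx) ⊔ Bn) B0 hle₁ hle₂
  -- `[𝒪_F ⊔ Bn : Bn] = [𝒪_F : 𝒪_F ⊓ Bn] = q^{⌈n/2⌉}`
  have hsec : Bn.relIndex ((B0 ⊓ Fx) ⊔ Bn) = Nat.card 𝓀[K] ^ ((n + 1) / 2) := by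
    rw [AddSubgroup.relIndex_sup_right, ← AddSubgroup.inf_relIndex_right Bn (B0 ⊓ Fx),
      show Bn ⊓ (B0 ⊓ Fx) = Bn ⊓ Fx by rw [← inf_assoc, inf_eq_left.2 hBn0]]
    exact relIndex_fixedBall_eq_pow hσ hvσ hfix hϖ hd n
  rw [hsec, relIndex_ball_neg_natCast_eq_pow hϖ n] at hmul
  -- `q^{⌈n/2⌉} · x = q^n ⇒ x = q^{⌊n/2⌋}`
  have hpow : Nat.card 𝓀[K] ^ n = Nat.card 𝓀[K] ^ ((n + 1) / 2) * Nat.card 𝓀[K] ^ (n / 2) := by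
    rw [← pow_add]; congr 1; omega
  rw [hpow] at hmul
  exact mul_left_cancel₀ (pow_ne_zero _ hq0) hmul

end Literature.NumberTheory.LocalFields.WildQuadraticDatum
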